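import Summits.Ventures.AbcSig.Rows.XTemplateC2a
import Summits.Ventures.AbcSig.Rows.C2aL347A0

/-!
# Venture AbcSig — ROW `C2aL347A0AB`: `347^m·xⁿ + yⁿ = z²` (second distribution, by symmetry), class `a = 0`, over the level files 11104 (norm-form certificates) and 694 (ordinary tree certificates) (GENERATED by p-lean g4 `gen4/c2arow2.py`)

HONEST FRAMING. A row of a COMPUTATION cell (`pub-abcsig`); a CONDITIONAL theorem, no claim on ABC or any summit.
Hypotheses: `BS04Package` (CITED: [BS04] Lemma 3.3 + (3.1) + Lemma 4.2); `DataComplete` at both levels and `RefinesCPSymAll` at the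
norm-form level(s) (COMPUTED: certified engine-1 level files; `Sieve/CharpolyCert.lean` / `Sieve/CharpolyTwist.lean`); `EisPackage` (CITED) + `Refines` (COMPUTED) for module-M6 residues discharged IN THE KERNEL at level 694;
and the listed per-orbit exclusions `hX_…` (CITED: the row of record's module closures — M4 Kraus / M6 / M8 / [BS04, Prop 4.4/4.6] as its R3
names them; nothing of those is checked here). Exponent range: prime `n ≥ 11`, `n ≠ 347`; `B = 2^0·347^m`, `1 ≤ m < n`
(RULING H1 reduced exponents).
Residual of record: none. CITED per the row of record's R3 at 11104: 11104.7 @ 29: M6c-old; 11104.10 @ 29: M6c-old. Level 694 (tree): 694.4 @ 29: M6; kernel M6 discharges 4:29.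
Row of record: `census/rows/C2a/C2a-l347-a0.md` (sha16 `23be5f51b474e60e`; SIGNED 2026-08-22T13:53:57Z by referee (ref-g10)).
-/

namespace Summit.Ventures.AbcSig

/-- Row `C2aL347A0AB`: `a = 0`, second distribution `(347^m, 1)` — the first with `x, y` swapped (`IsPrimitiveSolution.swap`). -/
theorem xrow_C2aL347A0AB (M : NewformModel) (hP : M.BS04Package)
    (hE : M.EisPackage)
    (hR_orbit_694_4 : M.Refines 694 orbit_694_4 m6X_694_4)
    (hD11104 : M.DataComplete 11104 level11104Orbits) (hCP11104 : M.RefinesCPSymAll 11104 level11104CP)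
    (hD694 : M.DataComplete 694 level694Orbits)
    (n : ℕ) (hn : n.Prime) (hmin : 11 ≤ n) (hnℓ : n ≠ 347) (m : ℕ) (hm : 1 ≤ m) (hmn : m < n)
    (hX_orbit_11104_7 : n ∈ ([29] : List ℕ) → M.Excludes 11104 orbit_11104_7
      (famB (2 ^ 0 * 347 ^ m) n (fun _ _ => True)))
    (hX_orbit_11104_10 : n ∈ ([29] : List ℕ) → M.Excludes 11104 orbit_11104_10
      (famB (2 ^ 0 * 347 ^ m) n (fun _ _ => True)))
    (x y z : ℤ) (hxy1 : x * y ≠ 1) (hxy2 : x * y ≠ -1) : ¬ IsPrimitiveSolution (347 ^ m) (2 ^ 0) 1 n x y z := by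
  intro h
  have h' : IsPrimitiveSolution 1 (2 ^ 0 * 347 ^ m) 1 n y x z := by simpa only [pow_zero, one_mul] using h.swap
  exact xrow_C2aL347A0 M hP hE hR_orbit_694_4 hD11104 hCP11104 hD694 n hn hmin hnℓ m hm hmn hX_orbit_11104_7 hX_orbit_11104_10 y x z (by rwa [mul_comm]) (by rwa [mul_comm]) h'

end Summit.Ventures.AbcSig
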